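import Summits.HodgeConjecture.HodgeConjecture.Theorems.CurveNetMordellWeilVerticalSupportMiddleChowDegenerate
import HarnessLib

/-!
# `stub_oneSidedRung` — THE ONE-SIDED RUNG (TRANSFER) of line `Sketch` of crux `SummitGrantedFourfolds`

Registered stub `stub_oneSidedRung` of line `Sketch` ("one-sided diagonal — Bloch–Srinivas one level
up") of crux `SummitGrantedFourfolds` (stmt-HodgeConjecture-14600, route `NoetherLefschetzOneUp` of
`HodgeConjecture`, `≡ HC(4;2,2) → HodgeConjecture`): for a Gysin / cycle-class formalism `G` with
Hodge-compatible Gysin morphisms, `q ≥ 2`, `X` smooth projective of dimension `2q` over `ℂ`, the Hodge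
conjecture in all dimensions `< 2q`, and a rational `(q,q)`-class `c` on `X` carrying a ONE-SIDED
HODGE-FIXING PAIR — `k • c = [Z']^* c + [Z'']^* c` with `k > 0`, `Z'`, `Z''` `2q`-cycles on `X × X`,
`pr₁(supp Z') ⊆ T ⊊ X` and `pr₂(supp Z'') ⊆ W ⊊ X` closed — the class `c` is algebraic.

PROOF (the last third of the proof of Voisin II, Prop. 10.26, p. 306, with the pair given instead of
coming from the decomposition of the diagonal; all inputs are theorems of the tree): `[Z']^* c` is
algebraic by `corrAct_mem_algebraicClasses_of_fst_of_hodgeBelowDim` ((10.8): coniveau `≥ 1`, rational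
and of type `(q,q)` through a resolution, Deligne descent + HC below), `[Z'']^* c` by
`corrAct_mem_algebraicClasses_of_snd_of_hodgeBelowDim` ((10.9): through a resolution of a component of
`W`, of dimension `< 2q`, + HC below); so `k • c` is algebraic, and `k ≠ 0` in `ℂ`.

## References

* [VoisinHodgeII2003] C. Voisin, Hodge Theory and Complex Algebraic Geometry II, Prop. 10.26 and its
  proof (p. 306), proof of Thm. 10.17 (10.8)–(10.9).
-/

-- `Summit.HodgeConjecture.HodgeConjecture.Theorems` is the mandated namespace (single-problem summit),
-- flagged by `linter.dupNamespace`; the lakefile turns the linter off tree-wide, restated here.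
set_option linter.dupNamespace false

noncomputable section

namespace Summit.HodgeConjecture.HodgeConjecture.Theorems

open CategoryTheory AlgebraicGeometry MonoidalCategory CartesianMonoidalCategory
open Literature.AlgebraicGeometry Literature.AlgebraicGeometry.Motives
  Literature.AlgebraicGeometry.HodgeTheory
open RegimeSplit

/-- **The one-sided rung (TRANSFER)** — stub `stub_oneSidedRung` of line `Sketch` of crux
`SummitGrantedFourfolds`. For a Gysin / cycle-class formalism `G` with Hodge-compatible Gysin
morphisms, `q ≥ 2`, `X` smooth projective of dimension `2q` over `ℂ`, the Hodge conjecture in all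
dimensions `< 2q`, and a rational `(q,q)`-class `c` on `X` with `k • c = [Z']^* c + [Z'']^* c` for
some `k > 0` and `2q`-cycles `Z'`, `Z''` on `X × X` with `pr₁(supp Z') ⊆ T ⊊ X`,
`pr₂(supp Z'') ⊆ W ⊊ X` (`T`, `W` Zariski-closed): `c` is algebraic. Both summands are algebraic
(`corrAct_mem_algebraicClasses_of_fst_of_hodgeBelowDim`, (10.8), and
`corrAct_mem_algebraicClasses_of_snd_of_hodgeBelowDim`, (10.9)), and `k ≠ 0` in `ℂ`.
[cite: VoisinHodgeII2003, proof of Prop. 10.26 (p. 306)] -/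
theorem stub_oneSidedRung :
    ∀ (G : Literature.AlgebraicGeometry.HodgeTheory.GysinFormalism), G.IsGysinHodgeCompatible →
    ∀ ⦃q : ℕ⦄ ⦃X : Literature.AlgebraicGeometry.Motives.SchemeOver ℂ⦄ (_ : 2 ≤ q)
      (hX : Literature.AlgebraicGeometry.Motives.IsSmoothProjective (2 * q) X),
      Summit.HodgeConjecture.HodgeConjecture.Theorems.RegimeSplit.HodgeBelowDim (2 * q) →
      ∀ c : Literature.AlgebraicGeometry.HodgeTheory.complexBetti X (2 * q),
        Literature.AlgebraicGeometry.HodgeTheory.IsRationalClass c →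
        Literature.AlgebraicGeometry.HodgeTheory.IsOfHodgeType (2 * q) X (2 * q) q q c →
        (∃ (k : ℕ) (T W : Set X.left)
            (Z' Z'' : ↥(Literature.AlgebraicGeometry.Motives.cyclesOfDim
              (CategoryTheory.MonoidalCategoryStruct.tensorObj X X).left (2 * q))),
            0 < k ∧ IsClosed T ∧ T ≠ Set.univ ∧ IsClosed W ∧ W ≠ Set.univ ∧
            (∀ z, (Z' : AlgebraicGeometry.AlgebraicCycle
                (CategoryTheory.MonoidalCategoryStruct.tensorObj X X).left ℤ) z ≠ 0 →
              (CategoryTheory.SemiCartesianMonoidalCategory.fst X X).left.base z ∈ T) ∧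
            (∀ z, (Z'' : AlgebraicGeometry.AlgebraicCycle
                (CategoryTheory.MonoidalCategoryStruct.tensorObj X X).left ℤ) z ≠ 0 →
              (CategoryTheory.SemiCartesianMonoidalCategory.snd X X).left.base z ∈ W) ∧
            (k : ℂ) • c = G.corrAct hX hX (2 * q) Z' c + G.corrAct hX hX (2 * q) Z'' c) →
        c ∈ Literature.AlgebraicGeometry.HodgeTheory.algebraicClasses X q := by
  intro G hG q X hq hX ih c hc hh hex
  obtain ⟨k, T, W, Z', Z'', hk, hT, hTne, hW, hWne, hZ'T, hZ''W, hkc⟩ := hex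
  -- both summands of `k • c = [Z']^* c + [Z'']^* c` are algebraic ((10.8), (10.9))
  have hmem : (k : ℂ) • c ∈ algebraicClasses X q := by
    rw [hkc]
    exact add_mem
      (corrAct_mem_algebraicClasses_of_fst_of_hodgeBelowDim G hG hX ih hT hTne hZ'T c hc hh)
      (corrAct_mem_algebraicClasses_of_snd_of_hodgeBelowDim G hX (by omega) ih hW hWne hZ''W c hc hh)
  -- `k ≠ 0` in `ℂ`
  have hk0 : (k : ℂ) ≠ 0 := by exact_mod_cast hk.ne'
  rwa [Submodule.smul_mem_iff _ hk0] at hmem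

end Summit.HodgeConjecture.HodgeConjecture.Theorems

end
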